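import Literature.MathematicalPhysics.QuantumFieldTheory.Balaban1983to89.HiggsFluctMeasureCov

/-!
# `Balaban1983to89.HiggsFluctFamilyMoments` — T. Bałaban, *(Higgs)₂,₃ quantum fields in a finite volume. I. A lower bound*,
Commun. Math. Phys. **85** (1982) 603–626 [Balaban1982Higgs1] p. 617: *"The fields A′_j defining the components of (3.33) are
independent Gaussian random variables with the covariances C^{(j),L^jε}"* — PROVED AT THE LEVEL OF THE FAMILY for the
concrete product measure `Π_{j<k} dμ_{C^{(j),L^jη}}(A′_j)` of III (1.4) p. 412 (`…HiggsFluctMeasure.fluctFamily P msq a k`,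
the product `Measure.pi` of the concrete Gaussian measures `fluctMeasure`): each factor is reflection invariant, the
coordinate reflections preserve the family, the one-field marginals are the `dμ_{C^{(j)}}`, and consequently
`E⟨A′_i,f⟩ = 0`, `E⟨A′_i,f⟩⟨A′_j,g⟩ = δ_{ij}⟨f, C^{(i)}g⟩`, `E exp(Σ_l⟨A′_l,f_l⟩) = exp(½Σ_l⟨f_l, C^{(l)}f_l⟩)` — the joint law
IS that of independent centred Gaussian fields with covariances `C^{(j),L^jη}`; regime `m² > 0` (vector mass `msq > 0`),
`a > 0`, `L > 1`, `k ≤ K`; theorems only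

statement-level skeleton of published theorems with citation tags; proofs where landed; nothing here is a claim about the Yang–Mills mass gap

PDF held: `paper:balaban1982-cmp85-higgs23-i` (journal page = PDF page + 602); p. 617 [PDF 15] read (`lit read … --pages 15`;
render `run/shared/lean/pub/pub-balaban/b2b-balaban-ref1/pages/1982-cmp85-higgs23-I/…-p015-x2.png`); III p. 412 (1.4) on
`…/1983-cmp88-higgs23-III/…-p002-x2.png`.

CITATION HEADER (lean-in-tree rule).  lit-balaban typed skeleton (HOME `run/shared/lean/pub/lit-balaban/`), typer
line, third companion of the carrier `HiggsFluctMeasure` (row **B3.Eq1.4**, owner r15; row B1.Eq3.33 of r14/r12 — the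
schematic product law `B1Eq333GaussianFields` — is NOT re-led here; this file proves the printed sentence for the
CONCRETE measures of the tree).  THE SOURCE TEXT, I p. 617 [PDF 15], verbatim: *"the field A with which we have started
in the first step is represented as A = A′^{(0),ε} + A′^{(1),ε} + … + A′^{(k−1),ε} + A^{(k),ε}, (3.33) where A′^{(j),ε} are
given by the formula (3.29) with A′_j instead of A. The fields A′_j defining the components of (3.33) are independent
Gaussian random variables with the covariances C^{(j),L^jε}. Also they are independent of the field A on the
L^kε-lattice, defining the configuration A^{(k),ε}."*; III p. 412 (1.4): *"Π_{j=0}^{k−1}∫dμ_{C^{(j),L^jη}}(A′_j)"*.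

THE ARGUMENT (ours; the paper states the sentence without proof — it is the definition of the product Gaussian
measure).  (§1) `dμ_{C^{(j)}}` (`fluctMeasure` = normalised even density `exp(−½⟨A′,(C^{(j)})^{−1}A′⟩)` against Lebesgue
measure `dA′`) is invariant under `A′ ↦ −A′` (change of variables in the Lebesgue integral of the density over `−S`;
`HiggsFluctMeasureCov.gaussWeight_neg`) — unconditional.  (§2) Hence the reflection of ONE coordinate,
`(A′_l)_l ↦ (…, −A′_i, …)`, preserves the product measure (`MeasureTheory.measurePreserving_pi`), and the `i`-th marginal
of the product of probability measures is `dμ_{C^{(i)}}` (`MeasureTheory.measurePreserving_eval`) — here the factors are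
probability measures by `HiggsFluctMeasurePos.fluctMeasure_isProbability` (`m² > 0`, `a > 0`, `L > 1`, levels `< k ≤ K`).
(§3) One-field moments reduce to `HiggsFluctMeasureCov` (`integral_siteInner_fluctMeasure`,
`integral_siteInner_mul_siteInner_fluctMeasure`); the mixed second moment `i ≠ j` changes sign under the reflection of
the `i`-th field, so it vanishes; the joint moment generating function factorises over the coordinates
(`MeasureTheory.integral_fin_nat_prod_eq_prod`) into the one-field ones (`integral_exp_siteInner_fluctMeasure`).
Unit `lit-balaban-typer` gen 4 (literature-prover-lit-balaban-typer-g4-0); HOME/FILED.md records the proposal.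
-/

open scoped BigOperators ENNReal InnerProductSpace
open _root_.MeasureTheory

namespace Literature.MathematicalPhysics.QuantumFieldTheory.Balaban1983to89.HiggsFluctFamilyMoments

open Literature.MathematicalPhysics.QuantumFieldTheory.Balaban1983to89.HiggsLattice
open Literature.MathematicalPhysics.QuantumFieldTheory.Balaban1983to89.HiggsAveraging
open Literature.MathematicalPhysics.QuantumFieldTheory.Balaban1983to89.HiggsCovariance
open Literature.MathematicalPhysics.QuantumFieldTheory.Balaban1983to89.B3MultiscaleFields
open Literature.MathematicalPhysics.QuantumFieldTheory.Balaban1983to89.HiggsFluctMeasure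
open Literature.MathematicalPhysics.QuantumFieldTheory.Balaban1983to89.HiggsCovariancePos
open Literature.MathematicalPhysics.QuantumFieldTheory.Balaban1983to89.HiggsCovarianceCont
open Literature.MathematicalPhysics.QuantumFieldTheory.Balaban1983to89.HiggsFluctMeasurePos
open Literature.MathematicalPhysics.QuantumFieldTheory.Balaban1983to89.HiggsFluctMeasureCov

variable {P : Params}

/-! ## 1. `dμ_{C^{(j),L^jη}}` is reflection invariant -/

section Reflection

/-- **`dμ_{C^{(j),L^jη}}(−A′) = dμ_{C^{(j),L^jη}}(A′)`**: the Gaussian measure of the `j`-th fluctuation field is invariant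
under `A′_j ↦ −A′_j` (even density, reflection-invariant `dA′_j`) — unconditional. [cite: Balaban1983Higgs3, (1.4) p.412] -/
theorem isNegInvariant_fluctMeasure (msq a : ℝ) (j : ℕ) : (fluctMeasure P msq a j).IsNegInvariant := by
  refine ⟨?_⟩
  show Measure.map Neg.neg (fluctMeasure P msq a j) = fluctMeasure P msq a j
  rw [fluctMeasure_eq, Measure.map_smul]
  congr 1
  ext s hs
  have hρ : Measurable fun A : VecField P j => ENNReal.ofReal (gaussWeight P msq a j A) :=
    (measurable_gaussWeight msq a j).ennreal_ofReal
  rw [Measure.map_apply measurable_neg hs, withDensity_apply _ (measurable_neg hs), withDensity_apply _ hs]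
  calc ∫⁻ A in Neg.neg ⁻¹' s, ENNReal.ofReal (gaussWeight P msq a j A) ∂volume
      = ∫⁻ A in Neg.neg ⁻¹' s, ENNReal.ofReal (gaussWeight P msq a j (-A)) ∂volume := by
        simp_rw [gaussWeight_neg]
    _ = ∫⁻ A in s, ENNReal.ofReal (gaussWeight P msq a j A) ∂(Measure.map Neg.neg volume) :=
        (setLIntegral_map hs hρ measurable_neg).symm
    _ = ∫⁻ A in s, ENNReal.ofReal (gaussWeight P msq a j A) ∂volume := by
        rw [Measure.map_neg_eq_self]

/-- The reflection `A′_j ↦ −A′_j` preserves `dμ_{C^{(j),L^jη}}`. [cite: Balaban1983Higgs3, (1.4) p.412] -/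
theorem measurePreserving_neg_fluctMeasure (msq a : ℝ) (j : ℕ) :
    MeasurePreserving (Neg.neg : VecField P j → VecField P j) (fluctMeasure P msq a j) (fluctMeasure P msq a j) := by
  haveI := isNegInvariant_fluctMeasure (P := P) msq a j
  exact Measure.measurePreserving_neg _

/-- In the paper's regime every factor `dμ_{C^{(l),L^lη}}`, `l < k ≤ K`, of the family is a probability measure
(`HiggsFluctMeasurePos.fluctMeasure_isProbability`). [cite: Balaban1983Higgs3, (1.4) p.412] -/
theorem fluctMeasure_isProbability_fin {msq a : ℝ} (hmsq : 0 < msq) (ha : 0 < a) (hL : 1 < (P.L : ℝ)) {k : ℕ}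
    (hk : k ≤ P.K) (l : Fin k) : IsProbabilityMeasure (fluctMeasure P msq a (l : ℕ)) :=
  fluctMeasure_isProbability hmsq ha hL ((Nat.le_of_lt l.isLt).trans hk)

/-- **Reflecting ONE fluctuation field preserves `Π_{j<k} dμ_{C^{(j),L^jη}}`**: the map
`(A′_l)_{l<k} ↦ (A′_0, …, −A′_i, …, A′_{k−1})` is measure preserving for the family (independence + reflection invariance
of the factors); `msq > 0`, `a > 0`, `L > 1`, `k ≤ K`. [cite: Balaban1982Higgs1, p.617] -/
theorem measurePreserving_negAt {msq a : ℝ} (hmsq : 0 < msq) (ha : 0 < a) (hL : 1 < (P.L : ℝ)) {k : ℕ}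
    (hk : k ≤ P.K) (i : Fin k) :
    MeasurePreserving (fun (A' : (l : Fin k) → VecField P l) (l : Fin k) => if l = i then -A' l else A' l)
      (fluctFamily P msq a k) (fluctFamily P msq a k) := by
  haveI : ∀ l : Fin k, IsProbabilityMeasure (fluctMeasure P msq a (l : ℕ)) :=
    fun l => fluctMeasure_isProbability_fin hmsq ha hL hk l
  have hfun : (fun (A' : (l : Fin k) → VecField P l) (l : Fin k) => if l = i then -A' l else A' l)
      = fun (A' : (l : Fin k) → VecField P l) (l : Fin k) =>
          (if l = i then (Neg.neg : VecField P l → VecField P l) else id) (A' l) := by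
    funext A' l
    split_ifs <;> rfl
  rw [fluctFamily_eq, hfun]
  refine measurePreserving_pi (fun l : Fin k => fluctMeasure P msq a (l : ℕ)) (fun l : Fin k => fluctMeasure P msq a (l : ℕ))
    (f := fun l : Fin k => if l = i then (Neg.neg : VecField P l → VecField P l) else id) fun l => ?_
  show MeasurePreserving (if l = i then (Neg.neg : VecField P l → VecField P l) else id) _ _
  split_ifs
  · exact measurePreserving_neg_fluctMeasure msq a l
  · exact MeasurePreserving.id _

end Reflection

/-! ## 2. Marginals: the law of `A′_i` under the family is `dμ_{C^{(i),L^iη}}` -/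

section Marginals

/-- **The one-field marginal of `Π_{j<k} dμ_{C^{(j),L^jη}}` is `dμ_{C^{(i),L^iη}}`**: `∫ F(A′_i) Π_j dμ_{C^{(j)}}(A′_j) =
∫ F dμ_{C^{(i)}}` (the other factors are probability measures); `msq > 0`, `a > 0`, `L > 1`, `k ≤ K`. [cite: Balaban1982Higgs1, p.617] -/
theorem integral_eval_fluctFamily {msq a : ℝ} (hmsq : 0 < msq) (ha : 0 < a) (hL : 1 < (P.L : ℝ)) {k : ℕ}
    (hk : k ≤ P.K) (i : Fin k) {E' : Type*} [NormedAddCommGroup E'] [NormedSpace ℝ E'] {F : VecField P i → E'}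
    (hF : AEStronglyMeasurable F (fluctMeasure P msq a i)) :
    ∫ A', F (A' i) ∂(fluctFamily P msq a k) = ∫ A, F A ∂(fluctMeasure P msq a i) := by
  haveI : ∀ l : Fin k, IsProbabilityMeasure (fluctMeasure P msq a (l : ℕ)) :=
    fun l => fluctMeasure_isProbability_fin hmsq ha hL hk l
  have h := measurePreserving_eval (fun l : Fin k => fluctMeasure P msq a (l : ℕ)) i
  rw [fluctFamily_eq]
  calc ∫ A', F (A' i) ∂(Measure.pi fun l : Fin k => fluctMeasure P msq a (l : ℕ))
      = ∫ A', F (Function.eval i A') ∂(Measure.pi fun l : Fin k => fluctMeasure P msq a (l : ℕ)) := rfl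
    _ = ∫ A, F A ∂(Measure.map (Function.eval i) (Measure.pi fun l : Fin k => fluctMeasure P msq a (l : ℕ))) := by
        refine (integral_map h.measurable.aemeasurable ?_).symm
        rw [h.map_eq]
        exact hF
    _ = ∫ A, F A ∂(fluctMeasure P msq a i) := by rw [h.map_eq]

/-- `A′ ↦ ⟨A′_i, f⟩` is continuous on the family. [cite: Balaban1982Higgs1, (1.5) p.604] -/
theorem continuous_siteInner_eval {k : ℕ} (i : Fin k) (f : VecField P i) :
    Continuous fun A' : (l : Fin k) → VecField P l => siteInner (toSite (A' i)) (toSite f) :=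
  continuous_siteInner (continuous_toSite.comp (continuous_apply i)) continuous_const

/-- `A′_i ↦ ⟨A′_i, f⟩` is continuous. [cite: Balaban1982Higgs1, (1.5) p.604] -/
theorem continuous_siteInner_toSite {j : ℕ} (f : VecField P j) :
    Continuous fun A : VecField P j => siteInner (toSite A) (toSite f) :=
  continuous_siteInner continuous_toSite continuous_const

end Marginals

/-! ## 3. The joint law: independent centred Gaussian fields with covariances `C^{(j),L^jη}` -/

section Moments

variable {msq a : ℝ} {k : ℕ}

/-- **Centred**: `∫⟨A′_i, f⟩ Π_j dμ_{C^{(j)}}(A′_j) = 0`. [cite: Balaban1982Higgs1, p.617] -/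
theorem integral_siteInner_fluctFamily (hmsq : 0 < msq) (ha : 0 < a) (hL : 1 < (P.L : ℝ)) (hk : k ≤ P.K)
    (i : Fin k) (f : VecField P i) :
    ∫ A', siteInner (toSite (A' i)) (toSite f) ∂(fluctFamily P msq a k) = 0 := by
  rw [integral_eval_fluctFamily hmsq ha hL hk i (F := fun A => siteInner (toSite A) (toSite f))
    (continuous_siteInner_toSite f).aestronglyMeasurable]
  exact integral_siteInner_fluctMeasure msq a i f

/-- **Covariance `C^{(i),L^iη}` on the diagonal**: `∫⟨A′_i, f⟩⟨A′_i, g⟩ Π_j dμ_{C^{(j)}}(A′_j) = ⟨f, C^{(i),L^iη}g⟩`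
(scalar product (1.5) on `T^{(i)}`, `C^{(i)}` = `HiggsFluctMeasure.fluctCov`). [cite: Balaban1982Higgs1, p.617] -/
theorem integral_siteInner_mul_siteInner_fluctFamily_self (hmsq : 0 < msq) (ha : 0 < a) (hL : 1 < (P.L : ℝ))
    (hk : k ≤ P.K) (i : Fin k) (f g : VecField P i) :
    ∫ A', siteInner (toSite (A' i)) (toSite f) * siteInner (toSite (A' i)) (toSite g) ∂(fluctFamily P msq a k)
      = siteInner (toSite f) (fluctCov P msq a i (toSite g)) := by
  rw [integral_eval_fluctFamily hmsq ha hL hk i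
    (F := fun A => siteInner (toSite A) (toSite f) * siteInner (toSite A) (toSite g))
    ((continuous_siteInner_toSite f).mul (continuous_siteInner_toSite g)).aestronglyMeasurable]
  exact integral_siteInner_mul_siteInner_fluctMeasure hmsq ha hL ((Nat.le_of_lt i.isLt).trans hk) f g

/-- **Independent (off the diagonal)**: `∫⟨A′_i, f⟩⟨A′_j, g⟩ Π_l dμ_{C^{(l)}}(A′_l) = 0` for `i ≠ j` (the integrand is odd
under the measure-preserving reflection of the `i`-th field). [cite: Balaban1982Higgs1, p.617] -/
theorem integral_siteInner_mul_siteInner_fluctFamily_ne (hmsq : 0 < msq) (ha : 0 < a) (hL : 1 < (P.L : ℝ))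
    (hk : k ≤ P.K) {i j : Fin k} (hij : i ≠ j) (f : VecField P i) (g : VecField P j) :
    ∫ A', siteInner (toSite (A' i)) (toSite f) * siteInner (toSite (A' j)) (toSite g) ∂(fluctFamily P msq a k)
      = 0 := by
  set R : ((l : Fin k) → VecField P l) → ((l : Fin k) → VecField P l) :=
    fun A' l => if l = i then -A' l else A' l with hRdef
  set Φ : ((l : Fin k) → VecField P l) → ℝ :=
    fun A' => siteInner (toSite (A' i)) (toSite f) * siteInner (toSite (A' j)) (toSite g) with hΦdef
  have hR : MeasurePreserving R (fluctFamily P msq a k) (fluctFamily P msq a k) :=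
    measurePreserving_negAt hmsq ha hL hk i
  have hΦ : Continuous Φ := (continuous_siteInner_eval i f).mul (continuous_siteInner_eval j g)
  -- integrate against the reflected family
  have h1 : ∫ A', Φ A' ∂(fluctFamily P msq a k) = ∫ A', Φ (R A') ∂(fluctFamily P msq a k) := by
    calc ∫ A', Φ A' ∂(fluctFamily P msq a k)
        = ∫ A', Φ A' ∂(Measure.map R (fluctFamily P msq a k)) := by rw [hR.map_eq]
      _ = ∫ A', Φ (R A') ∂(fluctFamily P msq a k) :=
          integral_map hR.measurable.aemeasurable (by rw [hR.map_eq]; exact hΦ.aestronglyMeasurable)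
  -- the integrand is odd under the reflection of the `i`-th field
  have h2 : ∀ A', Φ (R A') = -Φ A' := fun A' => by
    simp only [hΦdef, hRdef, ite_true, if_neg (Ne.symm hij), siteInner_toSite_neg, neg_mul]
  simp_rw [h2, integral_neg] at h1
  show ∫ A', Φ A' ∂(fluctFamily P msq a k) = 0
  linarith

/-- **The joint moment generating function factorises into the one-field Gaussian ones**:
`∫ exp(Σ_{l<k}⟨A′_l, f_l⟩) Π_l dμ_{C^{(l),L^lη}}(A′_l) = exp(½ Σ_{l<k}⟨f_l, C^{(l),L^lη}f_l⟩)` — the fields `A′_0, …, A′_{k−1}` ARE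
independent centred Gaussian random variables with the covariances `C^{(l),L^lη}`; `msq > 0`, `a > 0`, `L > 1`, `k ≤ K`.
PROVED. [cite: Balaban1982Higgs1, p.617] -/
theorem integral_exp_sum_siteInner_fluctFamily (hmsq : 0 < msq) (ha : 0 < a) (hL : 1 < (P.L : ℝ)) (hk : k ≤ P.K)
    (f : (l : Fin k) → VecField P l) :
    ∫ A', Real.exp (∑ l, siteInner (toSite (A' l)) (toSite (f l))) ∂(fluctFamily P msq a k)
      = Real.exp ((1 / 2) * ∑ l, siteInner (toSite (f l)) (fluctCov P msq a l (toSite (f l)))) := by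
  haveI : ∀ l : Fin k, IsProbabilityMeasure (fluctMeasure P msq a (l : ℕ)) :=
    fun l => fluctMeasure_isProbability_fin hmsq ha hL hk l
  rw [fluctFamily_eq]
  calc ∫ A', Real.exp (∑ l, siteInner (toSite (A' l)) (toSite (f l)))
        ∂(Measure.pi fun l : Fin k => fluctMeasure P msq a (l : ℕ))
      = ∫ A', ∏ l, Real.exp (siteInner (toSite (A' l)) (toSite (f l)))
          ∂(Measure.pi fun l : Fin k => fluctMeasure P msq a (l : ℕ)) := by
        simp_rw [Real.exp_sum]
    _ = ∏ l : Fin k, ∫ A, Real.exp (siteInner (toSite A) (toSite (f l))) ∂(fluctMeasure P msq a (l : ℕ)) :=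
        integral_fin_nat_prod_eq_prod (fun (l : Fin k) (A : VecField P l) => Real.exp (siteInner (toSite A) (toSite (f l))))
    _ = ∏ l : Fin k, Real.exp ((1 / 2) * siteInner (toSite (f l)) (fluctCov P msq a l (toSite (f l)))) :=
        Finset.prod_congr rfl fun l _ =>
          integral_exp_siteInner_fluctMeasure hmsq ha hL ((Nat.le_of_lt l.isLt).trans hk) (f l)
    _ = Real.exp ((1 / 2) * ∑ l, siteInner (toSite (f l)) (fluctCov P msq a l (toSite (f l)))) := by
        rw [Finset.mul_sum, Real.exp_sum]

/-- **Product of one-field observables factorises** (independence as printed): `∫ Π_l F_l(A′_l) Π_l dμ_{C^{(l)}}(A′_l) =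
Π_l ∫ F_l dμ_{C^{(l)}}`; `msq > 0`, `a > 0`, `L > 1`, `k ≤ K`. [cite: Balaban1982Higgs1, p.617] -/
theorem integral_prod_fluctFamily (hmsq : 0 < msq) (ha : 0 < a) (hL : 1 < (P.L : ℝ)) (hk : k ≤ P.K)
    (F : (l : Fin k) → VecField P l → ℝ) :
    ∫ A', ∏ l, F l (A' l) ∂(fluctFamily P msq a k) = ∏ l : Fin k, ∫ A, F l A ∂(fluctMeasure P msq a (l : ℕ)) := by
  haveI : ∀ l : Fin k, IsProbabilityMeasure (fluctMeasure P msq a (l : ℕ)) :=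
    fun l => fluctMeasure_isProbability_fin hmsq ha hL hk l
  rw [fluctFamily_eq]
  exact integral_fin_nat_prod_eq_prod F

end Moments

end Literature.MathematicalPhysics.QuantumFieldTheory.Balaban1983to89.HiggsFluctFamilyMoments
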